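import Summits.Ventures.CertifiedManyBodySolver.Downfold.RouterScoreHeaderReading

/-!
# Router-word score, part 4c: the MO-PRED-1 INCREMENT CUT — clause (A) «15 newly first-worded materials since the
# last cut», the first maps dir that carries the fifteenth, and the header-level PAIR arithmetic of an increment

Venture CertifiedManyBodySolver, cell `pub/hubbard-downfold`, seat hubbard-downfold-score-2 (session g22, 2026-08-30);
namespace `Summit.Ventures.CertifiedManyBodySolver.Downfold.RouterScore` (continues `RouterScoreHeaderReading.lean` p764710:
the header-level reading and the split census). Finite, PROVED bookkeeping statements; nothing here is physics.

The layer of record it mirrors: the MO-PRED-1 increment protocol (lead R-wa (A) / R-wt (A), precedents 1.21 / 1.22 / 1.23 = R-aac):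
score-2's `router/mopred_tally.py` counts, after the last cut, the WORDS rows that are a v8 material's FIRST word of record
(re-words, re-issues and further P columns of an already-worded material do not count; hold-out tranche rows and twins do not
count); clause (A) FIRES when that tally reaches 15; the annex (`mopred1_prereg.py --until …`) is cut on the FIRST oracle-dag
`maps/run-*` dir whose WORDS cut carries the fifteenth such row, and the pen equals its PEN-COMPARABLE HEADER-LEVEL PAIR.

* §1 `WordRow` = one WORDS row as the tally sees it (`first`, `counted`); `fwTally` = the number of counted first words;
  `clauseA k` = the tally has reached `k`. PROVED: the tally never decreases as rows are appended (`fwTally_le_append`), so once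
  clause (A) has fired it stays fired on every extension (`clauseA_append`) — the cut is the FIRST prefix where it fires and is
  unique (`cutPrefix`, `cutPrefix_spec`, `cutPrefix_min`): appending rows after the fifteenth does not move the cut row.
* §2 `MapsDir` = an assembled maps dir (WORDS rows at its cut, assembly clock); `cutDir row dirs` = the first-listed dir carrying
  `row`. PROVED: it carries the row and no earlier-listed dir does (`cutDir_spec`); when the dirs are listed with
  pairwise non-decreasing WORDS cuts (append-only ledger, assembly order), every later dir carries the row too (`carries_of_later`) — «the first dir carrying
  row 898» is a well-defined instruction, and a re-cut on a later dir would read a SUPERSET of rows, never fewer.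
* §3 The PAIR ARITHMETIC of an increment: the header-level PAIR of the new annex = the old PAIR + (the A-count of the increment)
  on both numerators and + (the increment size) on the denominator, PROVIDED every new first word reads the same under both word
  sets (true for rows first worded after T₀ = v0.7.0: the «words at the cut» and the «latest words» coincide on them) —
  `HeaderPair.step`; the calibrated gap (latest − at-cut) is invariant (`pair_gap_step`) and increments compose (`pair_step_step`);
  R(iii) of the increment = A / (A + P + D) (`incrementOf`, `Increment.size`).
* §4 The 1.23 instance (2026-08-30): the fifteen first words since the 1.22 cut 03:48:26Z in WORDS order with their
  header-level outcomes (M509 A · M511 A · M503 P · M273 P · M278 P · M473 A · M363 A · M343 P · M376 A · M267 A · M345 P ·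
  M333 A · M299 A · M290 A · M323 A): tally 15, clause (A) fires exactly at the fifteenth = WORDS row 898 (`mopred123_fires`,
  `mopred123_firstFire`), increment 10 A / 5 P / 0 D (`mopred123_increment`), the dirs 30zr (897 rows, 15:00:38Z) / 30zs
  (898 rows, 15:18:12Z) ⇒ cut dir = 30zs (`mopred123_cutDir`), and the PAIR 181/274 ∣ 195/274 → 191/289 ∣ 205/289
  (`mopred123_pair`).

WHAT THIS IS NOT: not the MO-PRED table of record (the pen's R-3 chain) and not a ruling on the trigger (the lead's R-wa / R-aac);
it is the counting rule and its arithmetic, so that «tally n/15», «cut on the first dir carrying row r» and «PAIR to equal» are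
mechanical sentences.
-/

namespace Summit.Ventures.CertifiedManyBodySolver.Downfold

namespace RouterScore

/-! ## §1 The tally of counted first words and the first prefix where clause (A) fires -/

/-- One WORDS row as `mopred_tally.py` classifies it: the material id, whether this row is the material's FIRST word of
record, whether the material counts (v8 tranche, not a hold-out, not a twin). [folklore] -/
structure WordRow where
  /-- material id (M323 ↦ 323) -/
  mat : ℕ
  /-- this row is the material's first word of record (not a re-word / re-issue / further P column) -/
  first : Bool
  /-- the material is counted (v8, not hold-out, not a twin row) -/
  counted : Bool
  deriving DecidableEq, Repr

/-- a row advances the tally iff it is a counted first word. [folklore] -/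
def WordRow.ticks (e : WordRow) : Bool := e.first && e.counted

/-- the tally of counted first words among the rows since the last cut. [folklore] -/
def fwTally (evs : List WordRow) : ℕ := evs.countP WordRow.ticks

/-- clause (A) with threshold `k` (= 15 of record): the tally has reached `k`. [folklore] -/
def clauseA (k : ℕ) (evs : List WordRow) : Bool := decide (k ≤ fwTally evs)

/-- the empty ledger has tally 0. [folklore] -/
@[simp] theorem fwTally_nil : fwTally [] = 0 := rfl

/-- one more row: the tally grows by one iff the row ticks. [folklore] -/
theorem fwTally_append_singleton (evs : List WordRow) (e : WordRow) :
    fwTally (evs ++ [e]) = fwTally evs + (if e.ticks then 1 else 0) := by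
  simp [fwTally, List.countP_append]

/-- appending rows never lowers the tally. [folklore] -/
theorem fwTally_le_append (evs more : List WordRow) : fwTally evs ≤ fwTally (evs ++ more) := by
  simp [fwTally, List.countP_append]

/-- a prefix has at most the tally of the whole. [folklore] -/
theorem fwTally_take_le (evs : List WordRow) (n : ℕ) : fwTally (evs.take n) ≤ fwTally evs := by
  have h := fwTally_le_append (evs.take n) (evs.drop n)
  rwa [List.take_append_drop] at h

/-- the tally is bounded by the number of rows. [folklore] -/
theorem fwTally_le_length (evs : List WordRow) : fwTally evs ≤ evs.length := List.countP_le_length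

/-- ONCE FIRED, ALWAYS FIRED: rows appended after the trigger do not un-fire clause (A). [folklore] -/
theorem clauseA_append {k : ℕ} {evs : List WordRow} (h : clauseA k evs = true) (more : List WordRow) :
    clauseA k (evs ++ more) = true := by
  simp only [clauseA, decide_eq_true_eq] at *
  exact Nat.le_trans h (fwTally_le_append evs more)

/-- `clauseA` unfolded. [folklore] -/
theorem clauseA_iff (k : ℕ) (evs : List WordRow) : clauseA k evs = true ↔ k ≤ fwTally evs := by
  simp [clauseA]

/-- the least prefix length at which clause (A) fires (the row of the k-th counted first word), if any. [folklore] -/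
def cutPrefix (k : ℕ) (evs : List WordRow) : Option ℕ :=
  (List.range (evs.length + 1)).find? fun n => clauseA k (evs.take n)

/-- the cut prefix fires. [folklore] -/
theorem cutPrefix_spec {k : ℕ} {evs : List WordRow} {n : ℕ} (h : cutPrefix k evs = some n) :
    clauseA k (evs.take n) = true := by
  unfold cutPrefix at h
  have := List.find?_some h
  simpa using this

/-- … and no shorter prefix does (the cut row is the k-th counted first word, not a later one). [folklore] -/
theorem cutPrefix_min {k : ℕ} {evs : List WordRow} {n : ℕ} (h : cutPrefix k evs = some n) {m : ℕ} (hm : m < n) :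
    clauseA k (evs.take m) = false := by
  unfold cutPrefix at h
  have hn : n ∈ List.range (evs.length + 1) := List.mem_of_find?_eq_some h
  obtain ⟨i, hi, hin, hbefore⟩ := List.find?_eq_some_iff_getElem.mp h |>.2
  have hi' : i = n := by simpa [List.getElem_range] using hin
  subst hi'
  have := hbefore m hm
  simpa [List.getElem_range] using this

/-- if clause (A) fires on the whole ledger, a cut prefix exists. [folklore] -/
theorem cutPrefix_isSome {k : ℕ} {evs : List WordRow} (h : clauseA k evs = true) : (cutPrefix k evs).isSome = true := by
  unfold cutPrefix
  rw [List.find?_isSome]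
  exact ⟨evs.length, List.mem_range.mpr (Nat.lt_succ_self _), by simpa using h⟩

/-! ## §2 The first maps dir carrying the cut row -/

/-- An assembled oracle-dag maps dir as the cut sees it: the number of WORDS rows in its cut and its assembly clock
(seconds of the day). [folklore] -/
structure MapsDir where
  /-- WORDS.tsv rows in the dir's cut -/
  rows : ℕ
  /-- assembly UTC as seconds since 00:00Z -/
  clock : ℕ
  deriving DecidableEq, Repr

/-- the dir carries WORDS row `r`. [folklore] -/
def MapsDir.carries (d : MapsDir) (r : ℕ) : Bool := decide (r ≤ d.rows)

/-- the FIRST-LISTED dir carrying row `r` (dirs listed in assembly order). [folklore] -/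
def cutDir (r : ℕ) (dirs : List MapsDir) : Option MapsDir := dirs.find? fun d => d.carries r

/-- the cut dir carries the row, and it is the first such in the list. [folklore] -/
theorem cutDir_spec {r : ℕ} {dirs : List MapsDir} {d : MapsDir} (h : cutDir r dirs = some d) :
    d.carries r = true ∧ ∃ i, ∃ hi : i < dirs.length, dirs[i] = d ∧ ∀ j, ∀ hj : j < i, (dirs[j]'(Nat.lt_trans hj hi)).carries r = false := by
  unfold cutDir at h
  refine ⟨by simpa using List.find?_some h, ?_⟩
  obtain ⟨i, hi, hid, hbefore⟩ := (List.find?_eq_some_iff_getElem.mp h).2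
  exact ⟨i, hi, hid, fun j hj => by simpa using hbefore j hj⟩

/-- under append-only WORDS (cuts pairwise non-decreasing along the listed assembly order), every dir listed after a
carrier carries the row too — so a re-cut on a later-named dir reads a superset of rows, never fewer. [folklore] -/
theorem carries_of_later {r : ℕ} {a b : MapsDir} {dirs : List MapsDir} (hmono : dirs.Pairwise fun x y => x.rows ≤ y.rows)
    (hab : List.Sublist [a, b] dirs) (h : a.carries r = true) : b.carries r = true := by
  have hp : List.Pairwise (fun x y => x.rows ≤ y.rows) [a, b] := hmono.sublist hab
  have hab' : a.rows ≤ b.rows := by simpa using hp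
  simp only [MapsDir.carries, decide_eq_true_eq] at *
  exact Nat.le_trans h hab'

/-! ## §3 The header-level PAIR arithmetic of an increment -/

/-- A header-level PAIR as the annex prints it: AGREE count under the words AT THE CUT (v0.6.x), AGREE count under the
LATEST words, common denominator (materials worded, excl. twins / supplementary). [folklore] -/
structure HeaderPair where
  /-- header-AGREE materials under the words at the cut -/
  atCut : ℕ
  /-- header-AGREE materials under the latest words -/
  latest : ℕ
  /-- worded materials (denominator) -/
  den : ℕ
  deriving DecidableEq, Repr

/-- the increment's header-level census: AGREE / PARTIAL / DISAGREE among the newly first-worded materials. [folklore] -/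
structure Increment where
  /-- header AGREE -/
  a : ℕ
  /-- header PARTIAL -/
  p : ℕ
  /-- header DISAGREE -/
  d : ℕ
  deriving DecidableEq, Repr

/-- increment size. [folklore] -/
def Increment.size (x : Increment) : ℕ := x.a + x.p + x.d

/-- the new PAIR after an increment whose materials read THE SAME under both word sets (rows first worded after T₀):
both numerators gain the A-count, the denominator gains the size. [folklore] -/
def HeaderPair.step (q : HeaderPair) (x : Increment) : HeaderPair := ⟨q.atCut + x.a, q.latest + x.a, q.den + x.size⟩

/-- the gap between the two numerators (the CALIBRATED re-word rows) is invariant under such an increment — the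
increment never manufactures a calibration gain. [folklore] -/
theorem pair_gap_step (q : HeaderPair) (x : Increment) : (q.step x).latest - (q.step x).atCut = q.latest - q.atCut := by
  simp [HeaderPair.step]
  omega

/-- two increments compose additively. [folklore] -/
theorem pair_step_step (q : HeaderPair) (x y : Increment) :
    (q.step x).step y = q.step ⟨x.a + y.a, x.p + y.p, x.d + y.d⟩ := by
  simp [HeaderPair.step, Increment.size]
  omega

/-- header-level census of a list of outcomes (the increment as read). [folklore] -/
def incrementOf (os : List Outcome) : Increment :=
  ⟨os.countP (· == .AGREE), os.countP (· == .PARTIAL), os.countP (· == .DISAGREE)⟩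

/-! ## §4 The MO-PRED-1.23 instance (cut 2026-08-30T15:18:12Z, RUN #391 = maps/run-2026-08-30zs; lead R-aac) -/

/-- a counted v8 first word. [folklore] -/
def evFirst (m : ℕ) : WordRow := ⟨m, true, true⟩

/-- a further WORDS row of an already-worded counted material (a P column, a re-word, a re-issue): does not tick. [folklore] -/
def evMore (m : ℕ) : WordRow := ⟨m, false, true⟩

/-- a row of a material outside the count (hold-out tranche / not v8 / twin), already worded: does not tick. [folklore] -/
def evOut (m : ℕ) : WordRow := ⟨m, false, false⟩

/-- the FIRST word of a material outside the count (M88 Th, VSET v3): does not tick either — `counted` matters. [folklore] -/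
def evFirstOut (m : ℕ) : WordRow := ⟨m, true, false⟩

/-- THE WORDS ROWS 872 … 898 SINCE THE 1.22 CUT (03:48:26Z; row 871 = BOX #431 M510 CrSb, the 1.22 trigger), in ledger order,
reduced to what the tally reads: 872 M509 · 873 M511 · 874 M503 · 875/876 M43 @2/@6 (hold-out re-word) · 877 M88 Th (v3 first
word) · 878/879 M273 @0/@11.7 · 880/881 M278 @0/@15 · 882 M473 · 883–887 M363 @0/2.2/3.1/3.7/5.9 · 888/889 M343 @0/@2 ·
890 M376 · 891/892 M267 @0/@2 · 893 M345 · 894/895 M333 @0/@2 · 896 M299 · 897 M290 · 898 M323. [folklore] -/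
def rows123 : List WordRow :=
  [evFirst 509, evFirst 511, evFirst 503, evOut 43, evOut 43, evFirstOut 88, evFirst 273, evMore 273, evFirst 278, evMore 278, evFirst 473, evFirst 363, evMore 363, evMore 363, evMore 363,
    evMore 363, evFirst 343, evMore 343, evFirst 376, evFirst 267, evMore 267, evFirst 345, evFirst 333, evMore 333, evFirst 299, evFirst 290, evFirst 323]

/-- 27 rows since the cut (872 … 898), tally 15: clause (A) fires. [folklore] -/
theorem mopred123_fires : rows123.length = 27 ∧ fwTally rows123 = 15 ∧ clauseA 15 rows123 = true := by decide

/-- … and it fires FIRST at the full prefix (row 898 = M323): the 26-row prefix (through row 897 = M290) has tally 14 —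
the «14/15» of every receipt between #445 and #446. [folklore] -/
theorem mopred123_firstFire : cutPrefix 15 rows123 = some 27 ∧ fwTally (rows123.take 26) = 14 := by decide

/-- the v3 first word (row 877, M88 Th) and the hold-out re-words (rows 875/876, M43) do not tick: dropping them leaves the
tally at 15. [folklore] -/
theorem mopred123_uncounted : fwTally (rows123.filter fun e => e.counted) = 15 ∧
    (rows123.filter fun e => !e.counted).length = 3 := by decide

/-- the header-level outcomes of the fifteen in order (receipts #… as registered): 10 A / 5 P / 0 D. [folklore] -/
def outcomes123 : List Outcome :=
  [.AGREE, .AGREE, .PARTIAL, .PARTIAL, .PARTIAL, .AGREE, .AGREE, .PARTIAL, .AGREE, .AGREE, .PARTIAL, .AGREE, .AGREE,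
    .AGREE, .AGREE]

/-- the 1.23 increment = 10 A / 5 P / 0 D, size 15; R(iii) numerator/denominator 10/15. [folklore] -/
theorem mopred123_increment : incrementOf outcomes123 = ⟨10, 5, 0⟩ ∧ (incrementOf outcomes123).size = 15 := by decide

/-- the two dirs around the trigger: 30zr (RUN #390; WORDS 897; assembled 15:00:38Z = 54038 s) and 30zs (RUN #391-cand.;
WORDS 898; 15:18:12Z = 55092 s). [folklore] -/
def dirs123 : List MapsDir := [⟨897, 54038⟩, ⟨898, 55092⟩]

/-- the cut dir for row 898 is 30zs, 30zr does not carry it, and the list is in append-only order. [folklore] -/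
theorem mopred123_cutDir : cutDir 898 dirs123 = some ⟨898, 55092⟩ ∧ (⟨897, 54038⟩ : MapsDir).carries 898 = false ∧
    dirs123.Pairwise (fun x y => x.rows ≤ y.rows) := by
  refine ⟨by decide, by decide, by simp [dirs123]⟩

/-- the 1.22 PAIR (181 ∣ 195 over 274) stepped by the 1.23 increment = 191 ∣ 205 over 289 — the numbers the pen equalled
(0.661 ∣ 0.709); the calibrated gap stays 14. [folklore] -/
theorem mopred123_pair : (⟨181, 195, 274⟩ : HeaderPair).step (incrementOf outcomes123) = ⟨191, 205, 289⟩ ∧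
    (205 : ℕ) - 191 = 195 - 181 := by decide

end RouterScore

end Summit.Ventures.CertifiedManyBodySolver.Downfold
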